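import Literature.Computability.QuantumComplexity.RevUncomputeUniform
import Literature.Computability.Complexity.SplitOnesBricks
import Literature.Computability.Complexity.CodeFPArith
import HarnessLib

/-!
# The input convention of a clean-compute block: data, parameters, terminator, unary data length

Topic `Literature/Computability/QuantumComplexity`, a small companion of `RevUncompute.lean`
(`RevClean.cleanOps e M n₀ v`: a reversible block running the machine `M` on the `n₀` data bits read off
the register followed by a CONSTANT suffix `v`, garbage-free; `RevClean.exists_outputsWithin_pow_of_mem_FP`:
every `FP` function has such a machine with a power time bound). A block that must work for all values
of its parameters (lattice basis, widths, moduli …) with ONE fixed machine — so that the circuit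
generator only writes the parameter string onto constant wires — receives the input

  `d ++ suffix w |d| = d ++ w ++ 0 ++ 1^{|d|+1}`

(`d` the data, `w` the parameter code): read from the right, the trailing block of `1`s gives `|d|`, the
word before its `0`, reversed back, is `d ++ w`. This file proves that convention sound and polynomial
time, once and for all:

* `suffix`, the total parser `splitFn u = (w, d)` (`splitFn_apply`), `codeFP_splitFn` (reversal,
  `SplitOnesBricks.onesPrefixFn/afterZeroFn`, `take`/`drop`);
* **`exists_blockFn`**: a map `F Q d` computed on codes from the PAIR code `⟨qE Q, d⟩` is computed by
  ONE `FP` function on the block inputs `d ++ suffix (qE Q) |d|`, for all parameters `Q` and data `d`;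
* **`exists_blockMachine`**: hence by one fixed machine with a power time bound (the datum `MachOK`-type
  hypotheses of the block files ask for).

Everything is proved; no named fact is introduced.

## References

* S. Arora, B. Barak, *Computational Complexity: A Modern Approach*, CUP 2009, §1.3 (robustness of
  polynomial time under input conventions; closure under composition) [AroraBarak2009].
* C. H. Bennett, *Logical reversibility of computation*, IBM J. Res. Develop. 17 (1973), §2 [Bennett1973].
-/

noncomputable section

namespace Literature.Computability.QuantumComplexity

open Literature.Computability.Complexity Literature.Computability.Complexity.CodeFP
open _root_.Computability RevSim RevClean Turing

namespace CleanBlockInput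

/-! ### The suffix and the parser -/

/-- **The suffix of a block input**: the parameter code, a `0`, and `1^{m+1}` (`m` the data length). [folklore] -/
def suffix (w : List Bool) (m : ℕ) : List Bool := w ++ false :: ones (m + 1)

/-- Length of the suffix. [folklore] -/
theorem length_suffix (w : List Bool) (m : ℕ) : (suffix w m).length = w.length + (m + 2) := by
  simp [suffix, ones]

/-- The parameter code is a prefix of the suffix. [folklore] -/
theorem length_le_length_suffix (w : List Bool) (m : ℕ) : w.length ≤ (suffix w m).length := by
  rw [length_suffix]; omega

/-- **The parser** of `u = d ++ w ++ 0 1^{|d|+1}`: `(w, d)`. [folklore] -/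
def splitFn (u : List Bool) : List Bool × List Bool :=
  (((afterZeroFn u.reverse).reverse).drop ((splitOnes u.reverse).1 - 1),
    ((afterZeroFn u.reverse).reverse).take ((splitOnes u.reverse).1 - 1))

/-- **The parser on a block input.** [folklore] -/
theorem splitFn_apply (d w : List Bool) : splitFn (d ++ suffix w d.length) = (w, d) := by
  have hrev : (d ++ suffix w d.length).reverse = ones (d.length + 1) ++ false :: (d ++ w).reverse := by
    simp [suffix, ones, List.reverse_append, List.reverse_replicate]
  unfold splitFn
  rw [hrev, splitOnes_ones_append, afterZeroFn_ones_append, List.reverse_reverse]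
  simp only [Nat.add_sub_cancel]
  rw [List.drop_left, List.take_left]

/-- **The parser is polynomial time.** [cite: AroraBarak2009, §1.3] -/
theorem codeFP_splitFn : CodeFP strE (pairE strE strE) splitFn := by
  -- reversal (`reverse_mem_FP`) and the unary predecessor (drop one `1`), as terms (twins exist in
  -- unrelated cones: `ZeroOneBPP.codeFP_reverse`, `TQBFRed.unPred`)
  have hrev : CodeFP strE strE List.reverse := ⟨List.reverse, reverse_mem_FP, fun _ => rfl⟩
  have hpred : CodeFP unE unE (fun n => n - 1) :=
    (strLength.comp (strDrop.comp ((const unE 1).pair strOfUn))).congr fun n => by simp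
  have hones : CodeFP strE unE (fun u => (splitOnes u).1) :=
    ⟨onesPrefixFn, onesPrefixFn_mem_FP, fun u => by rw [unE_eq_ones]; rfl⟩
  have hafter : CodeFP strE strE afterZeroFn := ⟨afterZeroFn, afterZeroFn_mem_FP, fun _ => rfl⟩
  have hj : CodeFP strE unE (fun u => (splitOnes u.reverse).1 - 1) := (hpred.comp (hones.comp hrev) :)
  have hdw : CodeFP strE strE (fun u => (afterZeroFn u.reverse).reverse) := (hrev.comp (hafter.comp hrev) :)
  have hw : CodeFP strE strE (fun u => ((afterZeroFn u.reverse).reverse).drop ((splitOnes u.reverse).1 - 1)) :=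
    (strDrop.comp (hj.pair hdw) :)
  have hd : CodeFP strE strE (fun u => ((afterZeroFn u.reverse).reverse).take ((splitOnes u.reverse).1 - 1)) :=
    (strTake.comp (hj.pair hdw) :)
  exact (hw.pair hd).congr fun _ => rfl

/-! ### One function, one machine, for all parameters -/

/-- **A map computed on pair codes is computed by ONE `FP` function on block inputs**, for all parameters
and data. [cite: AroraBarak2009, §1.3 (closure under composition)] -/
theorem exists_blockFn {β : Type} {qE : β → List Bool} {F : β → List Bool → List Bool}
    (hF : CodeFP (pairE qE strE) strE (fun p => F p.1 p.2)) :
    ∃ g : List Bool → List Bool, g ∈ FP ∧ ∀ (Q : β) (d : List Bool), g (d ++ suffix (qE Q) d.length) = F Q d := by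
  obtain ⟨fF, hfF, hF'⟩ := hF
  obtain ⟨fS, hfS, hS⟩ := codeFP_splitFn
  refine ⟨fF ∘ fS, comp_mem_FP hfF hfS, fun Q d => ?_⟩
  have h1 : fS (d ++ suffix (qE Q) d.length) = pairE qE strE (Q, d) := by
    have := hS (d ++ suffix (qE Q) d.length)
    rw [splitFn_apply] at this
    exact this
  rw [Function.comp_apply, h1, hF']
  rfl

/-- **Hence by one fixed machine with a power time bound.** [cite: AroraBarak2009, §1.3] [cite: Bennett1973, §2] -/
theorem exists_blockMachine {β : Type} {qE : β → List Bool} {F : β → List Bool → List Bool}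
    (hF : CodeFP (pairE qE strE) strE (fun p => F p.1 p.2)) :
    ∃ (e : ℕ) (M : TM2ComputableAux Bool Bool), ∀ (Q : β) (d : List Bool),
      M.OutputsWithin (d ++ suffix (qE Q) d.length) (F Q d) (Tn e (d ++ suffix (qE Q) d.length).length) := by
  obtain ⟨g, hg, hspec⟩ := exists_blockFn hF
  obtain ⟨e, M, hM⟩ := exists_outputsWithin_pow_of_mem_FP hg
  exact ⟨e, M, fun Q d => by rw [← hspec Q d]; exact hM _⟩

end CleanBlockInput

end Literature.Computability.QuantumComplexity

end
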